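import Summits.Ventures.YMGap.RobustBall.ConcentrationBall
import Summits.Ventures.YMGap.RobustBall.ConcentrationTorus
import Summits.Ventures.YMGap.Thresholds.StarSU3PV2TDimRows
import Summits.Ventures.YMGap.RobustBall.StarRowsSU3PV2T
import Summits.Ventures.YMGap.RobustBall.StarRowsSU3PV2TDim3
import Summits.Ventures.YMGap.RobustBall.AreaLawRowsSU3PV2T
import HarnessLib

/-!
# Venture statement — YMGap (cell `pub-ymgap`) — CONJUNCT BODIES T66 (= T66a–e), T71 (= T71a–d) (V23C, block 1)

STATUS: FILED by p3 g10 as V23C = T66 (= T66a–e) + T71 (= T71a–d) on the lead's ★ R322 V23C BOOKING (lead g11 = chair, bus 2026-08-24T15:39:28Z, INBOX l.6004, quoted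
verbatim: «V23C BOOKING = YES as staged (p3 g10 ask l.6002; R319 precedent): `StatementConjunctsV23C.lean` = T66a_SpecificationMcDiarmid · T66b_SU2WilsonSelfAveraging ·
T66c_SU2BallSelfAveraging · T66d_SU2WilsonPlaquetteSelfAveraging · T66e_TorusGaussianConcentration + T66_SpecificationConcentration (ds-3 g13 texts 7e4f5058398c1ef1 …) +
T71a_SU3TwistedPoincare · T71b_SU3EveryDimensionPV2T · T71c_SU3BallSegmentsPV2T · T71d_SU3AreaLawSegmentsPV2T + T71_SU3PV2TColumn (engine-2 g11 texts 8cdd715135e2f7a2 …)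
… (4) T65c (ds-4 `CentreBlindBallWindow`) joins V23C iff it is ACCEPTED AND its olean is in the store before the FINAL-SHA line, else V23D»). Owner consents: engine-2
(g12) NO-OBJECTION bus l.6016 (15:46:58Z); ds-3 (g14) «T66 TEXTS READY» bus l.6024 (15:51:36Z, by-import rc 0 15:51Z) and no objection by the 16:40Z window (R322 (1):
silence = consent). At the final-sha line (16:40Z 2026-08-24) `RobustBall/CentreBlindBallWindow` (ds-4, p381975, tree file d00382a6cee91066 since 15:44Z) had NO olean in
the hub store, so T65c opens V23D per R322 (4). Numbers: T66a–e / T66 by the lead (R294 l.4477 «T66 ds-3 concentration», R311, ★ R319 «T65c/T66 → V23C at their GREEN»);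
T71a–d / T71 assigned by p3 under lead g10's delegation (bus 2026-08-24T09:03:51Z «T-numbers (T71+) are p3's to assign») in GREEN order and announced on the bus before
filing. GREEN = parents are TREE modules with built oleans and the owner file answers a by-import `lean check` rc 0 / 0 warnings / std axioms (ds-3 text:
2026-08-24T15:36Z; engine-2 text: 2026-08-24T15:36Z; this block by import: 15:38Z). Texts, VERBATIM from the owner files: ds-3 g13
`HOME/ds/ds3/lean/g13/texts/V1XConjunctsDS3g13.lean` 7e4f5058398c1ef1 (T66a–e; parents `RobustBall/ConcentrationBall`, `RobustBall/ConcentrationTorus`) and engine-2 g11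
`HOME/pub-ymgap-engine-2/lean/T-texts-engine2-PV2T.lean` 8cdd715135e2f7a2 (T71a–d; parents `Thresholds/StarSU3PV2TDimRows`, `RobustBall/StarRowsSU3PV2T`,
`RobustBall/StarRowsSU3PV2TDim3`, `RobustBall/AreaLawRowsSU3PV2T`, commit 29dd74e5950b; owner line bus l.5945 (A)). Only decl names change (map `RENAMES-V23C.txt`: `T_X ↦
T66x_X` / `T71x_X`; the two consolidating conjunctions `T66_SpecificationConcentration`, `T71_SU3PV2TColumn` are p3's additions in the V20B/V22/V23 style, not owner
bytes); built mechanically by `mkmono23c.py` (= the V23 builder with the group section renamed); byte-compare `bytecmp.py --map` = verbatim-modulo-map. NOT IN THIS BLOCK: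
T65c (ds-4 g10's centre-blind ball text `V22ConjunctDS4g10.lean` 1f98dbb416b084be; its parent `RobustBall/CentreBlindBallWindow` — ds-4 p381975, tree bytes
d00382a6cee91066 since 15:44Z 2026-08-24 — had no olean in the hub store at the final-sha line, R322 (4)), T67a–d + T68a (rb-p2; parents not tree modules), rb-p1 g7/g8
`T_O`–`T_Z`, rb-p2 g9 texts, ds-4 g11/g12, ds-3 g14 and ds-1 g10/g11 texts (parents not yet tree modules or oleans not yet built; numbers T72+ are p3's) — they open
`StatementConjunctsV23D` / V24 at their GREEN (R294 numbered-PENDING discipline).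

HONEST FRAMING. WHAT THIS IS: bodies `Tk_… : Prop` + witnesses `Tk_…_holds`, kernel-checked with NO hypothesis, closing by TREE constants only. STRONG-COUPLING
LATTICE statements. (T66) GAUSSIAN CONCENTRATION OF SPATIAL AVERAGES: the McDiarmid–Azuma bound for the finite-volume kernels of ANY specification and for every
Gibbs measure of it (generic, no uniqueness needed), and the self-averaging of gauge-invariant local observables (incl. the plaquette) of `SU(2)` lattice
Yang–Mills on `ℤ⁴` at `0 ≤ β_W ≤ 1/12` (tree coupling `β_W/2`), uniformly on the tier-1 ball, and on the torus `(ℤ/L)^d` — Gaussian UPPER bounds with lossy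
explicit constants; not an LDP, not a CLT. (T71) the `SU(3)` PV2T COLUMN, HYPOTHESIS-FREE: the twisted one-link Poincaré constant `OneLinkPoincareSUN 3 R (1/K)`
for `K + (97/50)R ≤ 12/7`; in EVERY dimension `d ≥ 2` the mass gap `MassGapAt d 3 (β_W/9)` whenever `(d−1)|β_W| ≤ 23/20` with the rows `d = 3..6` and
`ImprovedThreshold d 3 x₀`; the robust segments `MassGapOnBallZdG 4 3 (β_W/9) (1/50) (1/100) R` (`0 ≤ β_W ≤ 2/5`), `MassGapOnBallZdG 3 3 (β_W/9) (1/25) (1/50) R`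
(`0 ≤ β_W ≤ 3/5`) and the area-law segments on the tier-1 ball (`d = 4` to `β_W = 1/2`, `d = 3` to `4/5`). Every window / threshold / radius is where a
one-link or Dobrushin-type BOUND closes (door artefacts), not a physical transition. WHAT THIS IS NOT: nothing for `SU(2)` in T71, nothing uniform in `N`, no
change to the certified `(H1 ∧ H2)` `SU(3)` column, no sharpness, nothing at the crossover couplings, no continuum limit, nothing about the Yang–Mills
Millennium problem.
-/

noncomputable section

namespace Summit.Ventures.YMGap

/-! ### OWNER FILE `owners/V1XConjunctsDS3g13.lean` (sha16 7e4f5058398c1ef1) — section `V23C_ds3_Concentration` -/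
section V23C_ds3_Concentration

/-!
Statement v1.x candidate conjuncts from ds-3's gen-13 files (TEXT for the p2/p3 seats; checkable once `ConcentrationBall.lean`,
`ConcentrationTorus.lean` and their parents are IN THE TREE; NOT proposed by ds-3). Y2 ROBUST-BALL, currency C-CONC: GAUSSIAN CONCENTRATION OF SPATIAL AVERAGES —
the McDiarmid–Azuma bound for the kernels of any specification (generic), and the self-averaging of every gauge-invariant local
observable of `SU(2)` lattice Yang–Mills on `ℤ⁴` at `0 ≤ β_W ≤ 1/12` and uniformly on the tier-1 ball. HONEST LABEL: strong-coupling
LATTICE statements inside the single-link doors; Gaussian UPPER bounds with lossy explicit constants; not an LDP, not a CLT; nothing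
continuum, nothing at the Y3 crossover couplings.
-/

open MeasureTheory Filter Topology
open scoped NNReal
open Literature.Probability.LatticeModels hiding configShift configShift_apply
open Literature.MathematicalPhysics.QuantumLattice (fundamentalRep ZdEdge LGConfig ymGibbsMeasures configShift ZdPlaquette plaquetteEdges)
open Literature.MathematicalPhysics.QuantumFieldTheory (IsLipschitzCylinder zdPlaquetteObs torusNorm suFrobDist GaugeConfig
  Edge)
open Literature.Probability.LatticeModels.DobrushinMetric (IsLipBound)
open Summit.Ventures.YMGap
open Summit.Ventures.YMGap.RobustBall

/-- **T66a_SpecificationMcDiarmid — GENERIC**: for EVERY specification `γ` on EVERY configuration space `V → S`, every finite volume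
`Λ₀`, every bounded measurable observable `f` and every vector `c ≥ 0` of uniform single-site boundary influences of `f` inside `Λ₀`
(`|∫ f dγ_{Λ'}(·|ω) − ∫ f dγ_{Λ'}(·|η)| ≤ c y` for `Λ' ⊆ Λ₀`, `y ∈ Λ₀ ∖ Λ'`, `ω = η` off `y`): for every boundary condition `ω` and
`r ≥ 0`, `γ_{Λ₀}({f − ∫ f dγ_{Λ₀}(·|ω) ≥ r} | ω) ≤ exp(−2 r² / Σ_{y ∈ Λ₀} c_y²)`, and for EVERY Gibbs measure `μ` of `γ` (no uniqueness)
`μ{f − ∫ f dγ_{Λ₀}(·|·) ≥ r} ≤ exp(−2 r² / Σ_{y ∈ Λ₀} c_y²)` (`SpecConcentration.measureReal_kernel_ge_le`,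
`SpecConcentration.measureReal_ge_kernel_integral_le`; SpecificationConcentration(Gibbs)). -/
def T66a_SpecificationMcDiarmid : Prop :=
  ∀ (V S : Type) [MeasurableSpace S] (γ : Specification V S), IsSpecification γ →
    ∀ (Λ₀ : Finset V) (f : (V → S) → ℝ), Measurable f → ∀ M : ℝ, (∀ σ, |f σ| ≤ M) →
    ∀ c : V → ℝ, (∀ y, 0 ≤ c y) →
    (∀ Λ', Λ' ⊆ Λ₀ → ∀ y ∈ Λ₀, y ∉ Λ' → ∀ ω η : V → S, (∀ z, z ≠ y → ω z = η z) →
      |(∫ σ, f σ ∂(γ Λ' ω)) - ∫ σ, f σ ∂(γ Λ' η)| ≤ c y) →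
    ∀ r : ℝ, 0 ≤ r →
      (∀ ω : V → S, (γ Λ₀ ω).real {σ | r ≤ f σ - ∫ τ, f τ ∂(γ Λ₀ ω)} ≤ Real.exp (-2 * r ^ 2 / ∑ y ∈ Λ₀, c y ^ 2)) ∧
      ∀ μ : Measure (V → S), IsGibbsMeasure γ μ →
        μ.real {σ | r ≤ f σ - ∫ τ, f τ ∂(γ Λ₀ σ)} ≤ Real.exp (-2 * r ^ 2 / ∑ y ∈ Λ₀, c y ^ 2)

/-- T66a_SpecificationMcDiarmid holds. -/
theorem T66a_SpecificationMcDiarmid_holds : T66a_SpecificationMcDiarmid :=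
  fun _ _ _ _ hγ Λ₀ _ hfm _ hM _ hc0 hc _ hr =>
    ⟨fun ω => SpecConcentration.measureReal_kernel_ge_le hγ Λ₀ hfm hM hc0 hc hr ω,
      fun _ hμ => SpecConcentration.measureReal_ge_kernel_integral_le hγ Λ₀ hfm hM hc0 hc le_rfl hμ hr⟩

/-- **T66b_SU2WilsonSelfAveraging — `SU(2)` LATTICE YANG–MILLS ON `ℤ⁴`, `0 ≤ β_W ≤ 1/12`** (tree coupling `β_W/2`): for EVERY DLR state
`μ`, every Lipschitz cylinder `f` (constant `K`, links `Δ`), every nonempty finite set `B` of lattice translations and every `a ≥ 0`: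
`μ{|Σ_{x∈B} f∘θ_x − ∫ Σ_{x∈B} f∘θ_x dμ| ≥ a·#B} ≤ 2 exp(−2 a² #B / (128 K² #Δ² Θ₁²))`, `Θ₁ = ((1 + e^{log(1/2)/4})/(1 − e^{log(1/2)/4}))⁴`
— the empirical average of any gauge-invariant local observable over `#B` translates deviates from its mean by `a` with probability
exponentially small in `#B` (`RobustBall.su2_wilson_translates_average_upTo_oneTwelfth`, ConcentrationBall). -/
def T66b_SU2WilsonSelfAveraging : Prop :=
  ∀ βW : ℝ, 0 ≤ βW → βW ≤ 1 / 12 →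
    ∀ μ ∈ ymGibbsMeasures (d := 4) (fundamentalRep (Fin 2)) (βW / 2),
    ∀ (f : LGConfig 4 (Matrix.specialUnitaryGroup (Fin 2) ℂ) → ℝ) (Δ : Finset (ZdEdge 4)) (K : ℝ≥0),
      IsLipschitzCylinder (fundamentalRep (Fin 2)) f Δ K → ∀ B : Finset (Site 4), B.Nonempty → ∀ a : ℝ, 0 ≤ a →
      μ.real {U | a * B.card ≤ |(∑ x ∈ B, f (configShift x U)) - ∫ U', ∑ x ∈ B, f (configShift x U') ∂μ|} ≤
        2 * Real.exp (-2 * a ^ 2 * B.card / (128 * (K : ℝ) ^ 2 * (Δ.card : ℝ) ^ 2 *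
          (((1 + Real.exp (Real.log (1 / 2) / 4)) / (1 - Real.exp (Real.log (1 / 2) / 4))) ^ 4) ^ 2))

/-- T66b_SU2WilsonSelfAveraging holds. -/
theorem T66b_SU2WilsonSelfAveraging_holds : T66b_SU2WilsonSelfAveraging :=
  fun _ h0 h _ hμ _ _ _ hf _ hB _ ha => su2_wilson_translates_average_upTo_oneTwelfth h0 h hμ hf hB ha

/-- **T66c_SU2BallSelfAveraging — `SU(2)`, `ℤ⁴`, HYPOTHESIS-FREE, UNIFORMLY ON THE TIER-1 BALL**: `6|β_W| e^{ε₀} + e^{ε₀/2}√(2/3) ε₁ ≤ ρ < 1`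
(`0 ≤ ρ`) ⇒ for every member of `MemBallZd ε₀ ε₁ R`, EVERY DLR state, every Lipschitz cylinder, nonempty `B`, `a ≥ 0`:
`μ{|Σ_{x∈B} f∘θ_x − ∫ Σ dμ| ≥ a·#B} ≤ 2 exp(−2 a² #B / (128 K² #Δ² Θ₁²))`, `Θ₁ = ((1+r₁)/(1−r₁))⁴`, `r₁ = exp(log max(ρ,½)/(4 max(1,R)))`
(`RobustBall.su2_translates_average_ge_le_dim4`, ConcentrationBall). -/
def T66c_SU2BallSelfAveraging : Prop :=
  ∀ βW ε₀ ε₁ ρ R : ℝ, 6 * |βW| * Real.exp ε₀ + Real.exp (ε₀ / 2) * Real.sqrt (2 / 3) * ε₁ ≤ ρ → 0 ≤ ρ → ρ < 1 →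
    ∀ (W : Potential (ZdEdge 4) (Matrix.specialUnitaryGroup (Fin 2) ℂ))
      (supp : Finset (ZdEdge 4) → Finset (Finset (ZdEdge 4))), MemBallZd ε₀ ε₁ R W supp →
    ∀ μ ∈ perturbedGibbsMeasures (d := 4) (fundamentalRep (Fin 2)) ((2 : ℕ) * (βW / 4)) W supp,
    ∀ (f : LGConfig 4 (Matrix.specialUnitaryGroup (Fin 2) ℂ) → ℝ) (Δ : Finset (ZdEdge 4)) (K : ℝ≥0),
      IsLipschitzCylinder (fundamentalRep (Fin 2)) f Δ K → ∀ B : Finset (Site 4), B.Nonempty → ∀ a : ℝ, 0 ≤ a →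
      μ.real {U | a * B.card ≤ |(∑ x ∈ B, f (configShift x U)) - ∫ U', ∑ x ∈ B, f (configShift x U') ∂μ|} ≤
        2 * Real.exp (-2 * a ^ 2 * B.card / (128 * (K : ℝ) ^ 2 * (Δ.card : ℝ) ^ 2 *
          (((1 + Real.exp (Real.log (max ρ (1 / 2)) / (4 * max 1 R))) /
            (1 - Real.exp (Real.log (max ρ (1 / 2)) / (4 * max 1 R)))) ^ 4) ^ 2))

/-- T66c_SU2BallSelfAveraging holds. -/
theorem T66c_SU2BallSelfAveraging_holds : T66c_SU2BallSelfAveraging :=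
  fun _ _ _ _ _ hρ hρ0 hρ1 _ _ hmem _ hμ _ _ _ hf _ hB _ ha => su2_translates_average_ge_le_dim4 hρ hρ0 hρ1 hmem hμ hf hB ha

/-- **T66d_SU2WilsonPlaquetteSelfAveraging — THE PLAQUETTE, `SU(2)` on `ℤ⁴`, `0 ≤ β_W ≤ 1/12`** (tree coupling `β_W/2`): for EVERY DLR
state `μ`, every plaquette observable `W_p` (`zdPlaquetteObs … x i j`, `i < j`), every nonempty finite set `B` of lattice translations and
every `a ≥ 0`: `μ{|Σ_{y∈B} W_p∘θ_y − ∫ Σ dμ| ≥ a·#B} ≤ 2 exp(−2 a² #B / (128·(4·2³)²·#links(p)²·Θ₁²))`,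
`Θ₁ = ((1 + e^{log(1/2)/4})/(1 − e^{log(1/2)/4}))⁴` — the mean plaquette of ANY finite region of `#B` sites deviates from its expectation by
`a` with probability exponentially small in `#B` (`RobustBall.su2_wilson_plaquette_average_upTo_oneTwelfth`, ConcentrationBall). -/
def T66d_SU2WilsonPlaquetteSelfAveraging : Prop :=
  ∀ βW : ℝ, 0 ≤ βW → βW ≤ 1 / 12 →
    ∀ μ ∈ ymGibbsMeasures (d := 4) (fundamentalRep (Fin 2)) (βW / 2),
    ∀ (x : Site 4) (i j : Fin 4) (hij : i < j) (B : Finset (Site 4)), B.Nonempty → ∀ a : ℝ, 0 ≤ a →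
      μ.real {U | a * B.card ≤ |(∑ y ∈ B, zdPlaquetteObs (d := 4) (fundamentalRep (Fin 2)) x i j (configShift y U)) -
          ∫ U', ∑ y ∈ B, zdPlaquetteObs (d := 4) (fundamentalRep (Fin 2)) x i j (configShift y U') ∂μ|} ≤
        2 * Real.exp (-2 * a ^ 2 * B.card / (128 * ((4 * (2 : ℝ≥0) ^ 3 : ℝ≥0) : ℝ) ^ 2 *
          ((plaquetteEdges ((x, ⟨(i, j), hij⟩) : ZdPlaquette 4)).card : ℝ) ^ 2 *
          (((1 + Real.exp (Real.log (1 / 2) / 4)) / (1 - Real.exp (Real.log (1 / 2) / 4))) ^ 4) ^ 2))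

/-- T66d_SU2WilsonPlaquetteSelfAveraging holds. -/
theorem T66d_SU2WilsonPlaquetteSelfAveraging_holds : T66d_SU2WilsonPlaquetteSelfAveraging :=
  fun _ h0 h _ hμ x _ _ hij _ hB _ ha => su2_wilson_plaquette_average_upTo_oneTwelfth h0 h hμ x hij hB ha

/-- **T66e_TorusGaussianConcentration — THE TORUS `(ℤ/L)^d`, UNIFORMLY ON THE TIER-1 BALL, from ds-2's robust torus door**:
`RobustTorusDoor N d β ε₀ ε₁ r ρ` with `0 ≤ ρ ≤ 1` ⇒ on every torus `L ≥ 3`, for every member `W ∈ ClusterDomainFR ε₀ ε₁ r`, every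
bounded measurable observable `f` depending on the links `Δ` with `suFrobDist`-Lipschitz vector `δ`, every
`V ≥ Σ_y (2√N Σ_{z∈Δ} δ_z ρ^{⌈‖z−y‖_T/(r⊔1)⌉₊})²` and every `a ≥ 0`: `μ_{β,W,L}{|f − ∫ f dμ_{β,W,L}| ≥ a} ≤ 2 exp(−2 a² / V)` — McDiarmid's
inequality for the torus Gibbs measure of lattice practice, no boundary term (`RobustBall.torus_measureReal_abs_ge_le_of_robustTorusDoor`,
ConcentrationTorus). -/
def T66e_TorusGaussianConcentration : Prop :=
  ∀ (N d : ℕ) (β ε₀ ε₁ ρ : ℝ) (r : ℕ), RobustTorusDoor N d β ε₀ ε₁ r ρ → 0 ≤ ρ → ρ ≤ 1 →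
    ∀ (L : ℕ) [NeZero L], 3 ≤ L → ∀ W : Perturbation d L N, W ∈ ClusterDomainFR ε₀ ε₁ r →
    ∀ (f : GaugeConfig d L (Matrix.specialUnitaryGroup (Fin N) ℂ) → ℝ) (Δ : Finset (Edge d L)) (M : ℝ) (δ : Edge d L → ℝ),
      Measurable f → DependsOn f (↑Δ : Set (Edge d L)) → (∀ U, |f U| ≤ M) → IsLipBound suFrobDist f δ →
    ∀ Vc : ℝ, ∑ y : Edge d L, (2 * Real.sqrt N *
        ∑ z ∈ Δ, δ z * ρ ^ ⌈(torusNorm (z.1 - y.1) : ℝ) / ((max r 1 : ℕ) : ℝ)⌉₊) ^ 2 ≤ Vc →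
    ∀ a : ℝ, 0 ≤ a →
      (W.perturbedMeasure (fundamentalRep (Fin N)) β).real
          {U | a ≤ |f U - ∫ U', f U' ∂(W.perturbedMeasure (fundamentalRep (Fin N)) β)|} ≤ 2 * Real.exp (-2 * a ^ 2 / Vc)

/-- T66e_TorusGaussianConcentration holds. -/
theorem T66e_TorusGaussianConcentration_holds : T66e_TorusGaussianConcentration :=
  fun _ _ _ _ _ _ _ hdoor hρ0 hρ1 _ _ hL _ hW _ _ _ _ hfm hfdep hM hδ _ hV _ ha =>
    torus_measureReal_abs_ge_le_of_robustTorusDoor hdoor hρ0 hρ1 hL hW hfm hfdep hM hδ hV ha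

end V23C_ds3_Concentration

/-! ### OWNER FILE `owners/T-texts-engine2-PV2T.lean` (sha16 8cdd715135e2f7a2) — section `V23C_engine2_PV2T` -/
section V23C_engine2_PV2T

/-!
# Venture statement — YMGap (cell `pub-ymgap`) — OWNER TEXT «engine-2 PV2T (twisted one-link Poincaré constant), SU(3), hypothesis-free» for the lead's
# V23 list (V22 carries the PV2 texts countersigned 2026-08-23T19:33Z); engine-2 g11.  STAGED — parents not yet in the tree at the time of writing.

HONEST FRAMING. WHAT THIS IS: kernel-checked strong-coupling LATTICE statements for `SU(3)` lattice Yang–Mills, HYPOTHESIS-FREE («no displayed one-link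
hypothesis»: the one-link input is engine-2 g11's TWISTED Poincaré constant `OneLinkPoincareSUN 3 R (1/K)`, `K + (97/50)R ≤ 12/7`
(`Thresholds/TwistedBochnerSU3.lean`: the isotropic third of the one-link Hessian cancels under J-SC13's S³-twist), combined with engine-2 g10's centred
Schwinger–Dyson variance through pub-balaban's door `K = √(c·v)`): (i) the Poincaré constant itself; (ii) in EVERY dimension `d ≥ 2` the mass gap
`MassGapAt d 3 (β_W/9)` whenever `(d−1)|β_W| ≤ 23/20`, the small-`d` rows `157/250 (d = 3)`, `51/125 (d = 4)`, `151/500 (d = 5)`, `6/25 (d = 6)` and the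
track-(a) types `ImprovedThreshold d 3 x₀`, `(d, x₀) = (3, 157/2250), (4, 17/375), (5, 151/4500), (6, 2/75)`; (iii) the ROBUST segments on the
gauge-invariant finite-range tier-1 ball `MassGapOnBallZdG 4 3 (β_W/9) (1/50) (1/100) R` for every `0 ≤ β_W ≤ 2/5` and `MassGapOnBallZdG 3 3 (β_W/9) (1/25) (1/50) R`
for every `0 ≤ β_W ≤ 3/5`; (iv) the AREA-LAW segments `AreaLawOnBall 3 4 (β_W/3) (97/500) (97/1000) r mv` for every `0 ≤ β_W ≤ 1/2` and
`AreaLawOnBall 3 3 (β_W/3) (13/100) (13/200) r mv` for every `0 ≤ β_W ≤ 4/5`.  HONEST LABEL: thresholds / radii are where the doors close (door artefacts),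
strong coupling only; supersedes the V22 PV2 texts `T_SU3EveryDimensionPV2` / `T_SU3BallSegmentsPV2` in reach, not in kind.
NOT CLAIMED: anything for SU(2); uniformity in N (nothing for N ≥ 4); any change to the CERTIFIED (H1 ∧ H2) SU(3) column; sharpness; anything about the
crossover, the continuum, or the Clay problem.
-/



section Engine2PV2Tsec

open Literature.MathematicalPhysics.QuantumLattice
open Literature.MathematicalPhysics.QuantumFieldTheory
open Summit.QuantumFields.BalabanUV.InfraRed.StrongCouplingPoincareDoorSUN (OneLinkPoincareSUN)
open Summit.Ventures.YMGap.RobustBall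
open Summit.Ventures.YMGap.RobustBallPV
open Summit.Ventures.YMGap.StarSU3PV2TDim
open Summit.Ventures.YMGap.TwistedBochner

/-- **T71a_SU3TwistedPoincare — `SU(3)`, HYPOTHESIS-FREE**: the twisted one-link Poincaré constant: for every `0 < K` and `R` with `K + (97/50)R ≤ 12/7`,
`OneLinkPoincareSUN 3 R (1/K)` (`TwistedBochner.oneLinkPoincareSUN_su3_twisted`; Bakry–Émery: `1/(3(1/2 − R))`, `R < 1/2`). -/
def T71a_SU3TwistedPoincare : Prop :=
  ∀ R K : ℝ, 0 < K → K + 97 / 50 * R ≤ 12 / 7 → OneLinkPoincareSUN 3 R (1 / K)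

/-- T71a_SU3TwistedPoincare holds. -/
theorem T71a_SU3TwistedPoincare_holds : T71a_SU3TwistedPoincare := fun _ _ hK h => oneLinkPoincareSUN_su3_twisted hK h

/-- **T71b_SU3EveryDimensionPV2T — `SU(3)`, EVERY `d ≥ 2`, HYPOTHESIS-FREE (twisted constant)**: (i) `(d−1)|β_W| ≤ 23/20 ⇒ MassGapAt d 3 (β_W/9)`
(`StarSU3PV2TDim.su3_massGapAt_dim_pv2t_uniform`); (ii) `d = 3, 4, 5, 6` rows at `|β_W| ≤ 157/250, 51/125, 151/500, 6/25`; (iii) `ImprovedThreshold 3 3 (157/2250) ∧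
ImprovedThreshold 4 3 (17/375) ∧ ImprovedThreshold 5 3 (151/4500) ∧ ImprovedThreshold 6 3 (2/75)`. -/
def T71b_SU3EveryDimensionPV2T : Prop :=
  (∀ d : ℕ, 2 ≤ d → ∀ βW : ℝ, ((d : ℝ) - 1) * |βW| ≤ 23 / 20 → MassGapAt d 3 (βW / 9)) ∧
  (∀ βW : ℝ, |βW| ≤ 157 / 250 → MassGapAt 3 3 (βW / 9)) ∧
  (∀ βW : ℝ, |βW| ≤ 51 / 125 → MassGapAt 4 3 (βW / 9)) ∧
  (∀ βW : ℝ, |βW| ≤ 151 / 500 → MassGapAt 5 3 (βW / 9)) ∧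
  (∀ βW : ℝ, |βW| ≤ 6 / 25 → MassGapAt 6 3 (βW / 9)) ∧
  (ImprovedThreshold 3 3 (157 / 2250) ∧ ImprovedThreshold 4 3 (17 / 375) ∧ ImprovedThreshold 5 3 (151 / 4500) ∧ ImprovedThreshold 6 3 (2 / 75))

/-- T71b_SU3EveryDimensionPV2T holds. -/
theorem T71b_SU3EveryDimensionPV2T_holds : T71b_SU3EveryDimensionPV2T :=
  ⟨fun _ hd _ h => su3_massGapAt_dim_pv2t_uniform hd h, fun _ h => su3_three_massGapAt_pv2t h, fun _ h => su3_four_massGapAt_pv2t h,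
    fun _ h => su3_five_massGapAt_pv2t h, fun _ h => su3_six_massGapAt_pv2t h,
    ⟨improvedThreshold_su3_three_pv2t, improvedThreshold_su3_four_pv2t, improvedThreshold_su3_five_pv2t, improvedThreshold_su3_six_pv2t⟩⟩

/-- **T71c_SU3BallSegmentsPV2T — `SU(3)`, the PV2T SEGMENTS on the gauge-invariant tier-1 ball, HYPOTHESIS-FREE**:
`∀ 0 ≤ β_W ≤ 2/5, ∀ R, MassGapOnBallZdG 4 3 (β_W/9) (1/50) (1/100) R` (`RobustBall.su3_massGapOnBallZdG_pv2tStar_upTo_twoFifths`) and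
`∀ 0 ≤ β_W ≤ 3/5, ∀ R, MassGapOnBallZdG 3 3 (β_W/9) (1/25) (1/50) R` (`RobustBall.su3_massGapOnBallZdG_dim3_pv2tStar_upTo_threeFifths`). -/
def T71c_SU3BallSegmentsPV2T : Prop :=
  (∀ βW : ℝ, 0 ≤ βW → βW ≤ 2 / 5 → ∀ R : ℕ, MassGapOnBallZdG 4 3 (βW / 9) (1 / 50) (1 / 100) R) ∧
  (∀ βW : ℝ, 0 ≤ βW → βW ≤ 3 / 5 → ∀ R : ℕ, MassGapOnBallZdG 3 3 (βW / 9) (1 / 25) (1 / 50) R)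

/-- T71c_SU3BallSegmentsPV2T holds. -/
theorem T71c_SU3BallSegmentsPV2T_holds : T71c_SU3BallSegmentsPV2T :=
  ⟨fun _ h0 h R => su3_massGapOnBallZdG_pv2tStar_upTo_twoFifths h0 h R,
    fun _ h0 h R => su3_massGapOnBallZdG_dim3_pv2tStar_upTo_threeFifths h0 h R⟩

/-- **T71d_SU3AreaLawSegmentsPV2T — `SU(3)`, the PV2T AREA-LAW SEGMENTS on the tier-1 ball, HYPOTHESIS-FREE**:
`∀ 0 ≤ β_W ≤ 1/2, ∀ r, ∀ mv ≥ 1, AreaLawOnBall 3 4 (β_W/3) (2·(97/1000)) (97/1000) r mv` (`RobustBallPV.su3_pv2tRow4_upTo_1_2`) and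
`∀ 0 ≤ β_W ≤ 4/5, ∀ r, ∀ mv ≥ 1, AreaLawOnBall 3 3 (β_W/3) (2·(13/200)) (13/200) r mv` (`RobustBallPV.su3_pv2tRow3_upTo_4_5`). -/
def T71d_SU3AreaLawSegmentsPV2T : Prop :=
  (∀ βW : ℝ, 0 ≤ βW → βW ≤ 1 / 2 → ∀ r : ℕ, ∀ mv : ℕ, 1 ≤ mv → AreaLawOnBall 3 4 (βW / 3) (2 * (97 / 1000)) (97 / 1000) r mv) ∧
  (∀ βW : ℝ, 0 ≤ βW → βW ≤ 4 / 5 → ∀ r : ℕ, ∀ mv : ℕ, 1 ≤ mv → AreaLawOnBall 3 3 (βW / 3) (2 * (13 / 200)) (13 / 200) r mv)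

/-- T71d_SU3AreaLawSegmentsPV2T holds. -/
theorem T71d_SU3AreaLawSegmentsPV2T_holds : T71d_SU3AreaLawSegmentsPV2T :=
  ⟨fun _ h0 h r _ hmv => su3_pv2tRow4_upTo_1_2 h0 h r hmv, fun _ h0 h r _ hmv => su3_pv2tRow3_upTo_4_5 h0 h r hmv⟩

end Engine2PV2Tsec



end V23C_engine2_PV2T

/-! ### DEFAULT GROUPING (p2): one consolidating conjunction per owner file — `G_<tag> := T_a ∧ T_b ∧ …` + `_holds`.
The lead composes V23C by theme; p3 renames `G_<tag> ↦ T<k>_<Name>` (via --map) or regroups at will; these are additions, not owner bytes. -/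
section V23C_groups

/-- Default group for section `V23C_ds3_Concentration`: the conjunction of its 5 owner texts. -/
def T66_SpecificationConcentration : Prop :=
  T66a_SpecificationMcDiarmid ∧ T66b_SU2WilsonSelfAveraging ∧ T66c_SU2BallSelfAveraging ∧ T66d_SU2WilsonPlaquetteSelfAveraging ∧ T66e_TorusGaussianConcentration

/-- `T66_SpecificationConcentration` holds (componentwise by the owners' `_holds`). -/
theorem T66_SpecificationConcentration_holds : T66_SpecificationConcentration :=
  ⟨T66a_SpecificationMcDiarmid_holds, T66b_SU2WilsonSelfAveraging_holds, T66c_SU2BallSelfAveraging_holds, T66d_SU2WilsonPlaquetteSelfAveraging_holds, T66e_TorusGaussianConcentration_holds⟩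

/-- Default group for section `V23C_engine2_PV2T`: the conjunction of its 4 owner texts. -/
def T71_SU3PV2TColumn : Prop :=
  T71a_SU3TwistedPoincare ∧ T71b_SU3EveryDimensionPV2T ∧ T71c_SU3BallSegmentsPV2T ∧ T71d_SU3AreaLawSegmentsPV2T

/-- `T71_SU3PV2TColumn` holds (componentwise by the owners' `_holds`). -/
theorem T71_SU3PV2TColumn_holds : T71_SU3PV2TColumn :=
  ⟨T71a_SU3TwistedPoincare_holds, T71b_SU3EveryDimensionPV2T_holds, T71c_SU3BallSegmentsPV2T_holds, T71d_SU3AreaLawSegmentsPV2T_holds⟩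

end V23C_groups

end Summit.Ventures.YMGap

end
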